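import Summits.ResolutionOfSingularities.ResolutionOfSingularities.Theorems.FrobeniusLadderFRationalResolutionLocalToricModelBlowup
import HarnessLib

/-!
# Crux `FrobeniusLadder.FRationalResolution` (stmt-ResolutionOfSingularities-15317), line `redirect`,
# stub `stub_diagonalizableQuotientResolution` — THE SECOND-STEP BRICK IN THE SHAPE OF `hmodel`: chart data AT A PRIME `𝔫` of a
# chart ring `C` (e.g. `C = κ[P][𝔳^{a+1}/xᵢ]`, `𝔫` a torus-fixed point) ⇒ `Bl_𝔫(Spec C_𝔫)` regular

`…LocalToricModelBlowup` (p843291) resolves the point blow-up of a toric-charted LOCAL ring. The two-step consumers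
(`…EtaleChartTwoStepModelScheme.hloc_of_model_charts_etale_nhd`, `…FixedPointTwoStepModel…`) ask, at every non-regular prime `𝔫`
over `𝔳` of the chart rings `C = T[𝔳^{a+1}/xᵢ]`, for `Scheme.IsRegular (affineBlowup (R := Localization.AtPrime 𝔫) (maximalIdeal _))`
— literally the conclusion here, from chart data by elements of `C` (`χ : ℕⁿ → C` multiplicative on a finitely generated `P`,
`χ(P ∖ 0) ⊆ 𝔫` generating `𝔫`, `dim C_𝔫 = rank P`; `C` Noetherian containing a field, `i : K →+* C`) and a certificate for the
model over `κ(𝔫)`: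

* ★★ `isRegular_affineBlowup_atPrime_of_chartData_model` — any charted model `(T, 𝔳, χ₀)` of finite type over `κ(𝔫)` with
  `Bl_𝔳(Spec T)` regular;
* ★★★ `isRegular_affineBlowup_atPrime_of_chartData` — the monomial model `κ(𝔫)[χᵈ : d ∈ G]` (`⟨G⟩ = P`) with regular vertex blow-up;
* ★★★ `isRegular_affineBlowup_atPrime_of_veroneseChart` — the Veronese monoid `{m : r ∣ |m|}`, `dim C_𝔫 = n`: NO certificate.

Honest label: helper theorems toward ONE leaf stub (no stub, crux or summit closed). No definitions, no named facts, no sorry.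
[cite: Kato1994, Thm. (3.2)] [cite: Matsumura1987, Thm. 8.11; Thm. 8.14; §32 p. 256] [cite: StacksProject, Tag 07PT]
-/

noncomputable section

-- single-problem summit: the doubled namespace component is forced
set_option linter.dupNamespace false

open AlgebraicGeometry IsLocalRing
open Literature.RingTheory.MvPowerSeries Literature.RingTheory.MvPowerSeries.monoidPowerSeries
open Literature.AlgebraicGeometry.Resolution

namespace Summit.ResolutionOfSingularities.ResolutionOfSingularities.Theorems.FRationalResolution.LocalToricModelBlowup

variable {n : ℕ} {C : Type} [CommRing C] (𝔫 : Ideal C) [𝔫.IsPrime]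

/-- Chart data by elements of `C` at a prime `𝔫` localize to d = 0 chart data on `C_𝔫`. [folklore; cite: Kato1994, Def. (2.1)] -/
theorem chartData_atPrime (P : AddSubmonoid (Fin n →₀ ℕ))
    (χ : (Fin n →₀ ℕ) → C) (hχ0 : χ 0 = 1) (hχadd : ∀ a ∈ P, ∀ b ∈ P, χ (a + b) = χ a * χ b)
    (hχm : ∀ p ∈ P, p ≠ 0 → χ p ∈ 𝔫) (hgen : 𝔫 ≤ Ideal.span (χ '' {p | p ∈ P ∧ p ≠ 0})) :
    (fun p => algebraMap C (Localization.AtPrime 𝔫) (χ p)) 0 = 1 ∧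
      (∀ a ∈ P, ∀ b ∈ P, (fun p => algebraMap C (Localization.AtPrime 𝔫) (χ p)) (a + b) =
        (fun p => algebraMap C (Localization.AtPrime 𝔫) (χ p)) a *
          (fun p => algebraMap C (Localization.AtPrime 𝔫) (χ p)) b) ∧
      (∀ p ∈ P, p ≠ 0 → (fun p => algebraMap C (Localization.AtPrime 𝔫) (χ p)) p ∈
        maximalIdeal (Localization.AtPrime 𝔫)) ∧
      maximalIdeal (Localization.AtPrime 𝔫) ≤
        Ideal.span ((fun p => algebraMap C (Localization.AtPrime 𝔫) (χ p)) '' {p | p ∈ P ∧ p ≠ 0}) := by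
  refine ⟨by simp only [hχ0, map_one], fun a ha b hb => by simp only [hχadd a ha b hb, map_mul], ?_, ?_⟩
  · intro p hp hp0
    rw [← Localization.AtPrime.map_eq_maximalIdeal]
    exact Ideal.mem_map_of_mem _ (hχm p hp hp0)
  · rw [← Localization.AtPrime.map_eq_maximalIdeal]
    refine (Ideal.map_mono hgen).trans ?_
    rw [Ideal.map_span, ← Set.image_comp]
    rfl

/-- ★★ **`Bl_𝔫(Spec C_𝔫)` IS REGULAR from chart data at `𝔫` and ANY charted model with regular blow-up.** `C` Noetherian
containing a field `K`, `𝔫` prime; `χ : ℕⁿ → C` with `χ 0 = 1`, multiplicative on a finitely generated `P`, `χ(P ∖ 0) ⊆ 𝔫`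
generating `𝔫`, `dim C_𝔫 = rank P`; a model `T` of finite type over `κ(𝔫)`, `𝔳` maximal `κ(𝔫)`-rational, charted by `P`,
`dim T_𝔳 = rank P`, `Bl_𝔳(Spec T)` regular. [cite: Kato1994, Thm. (3.2)] [cite: Matsumura1987, Thm. 8.11; Thm. 8.14; §32 p. 256] -/
theorem isRegular_affineBlowup_atPrime_of_chartData_model [IsNoetherianRing C] {K : Type} [Field K] (i : K →+* C)
    (P : AddSubmonoid (Fin n →₀ ℕ)) (hPfg : P.FG)
    (χ : (Fin n →₀ ℕ) → C) (hχ0 : χ 0 = 1) (hχadd : ∀ a ∈ P, ∀ b ∈ P, χ (a + b) = χ a * χ b)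
    (hχm : ∀ p ∈ P, p ≠ 0 → χ p ∈ 𝔫) (hgen : 𝔫 ≤ Ideal.span (χ '' {p | p ∈ P ∧ p ≠ 0}))
    (hdim : ringKrullDim (Localization.AtPrime 𝔫) = rank P)
    (T : Type) [CommRing T] [Algebra (ResidueField (Localization.AtPrime 𝔫)) T]
    [Algebra.FiniteType (ResidueField (Localization.AtPrime 𝔫)) T] (𝔳 : Ideal T) [𝔳.IsMaximal]
    (hres : ∀ z : Localization.AtPrime 𝔳, ∃ c : ResidueField (Localization.AtPrime 𝔫),
      z - algebraMap _ (Localization.AtPrime 𝔳) c ∈ maximalIdeal (Localization.AtPrime 𝔳))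
    (χ₀ : (Fin n →₀ ℕ) → T) (hχ₀0 : χ₀ 0 = 1) (hχ₀add : ∀ a ∈ P, ∀ b ∈ P, χ₀ (a + b) = χ₀ a * χ₀ b)
    (hχ₀m : ∀ p ∈ P, p ≠ 0 → χ₀ p ∈ 𝔳) (hgen₀ : 𝔳 ≤ Ideal.span (χ₀ '' {p | p ∈ P ∧ p ≠ 0}))
    (hdim₀ : ringKrullDim (Localization.AtPrime 𝔳) = rank P)
    (hreg : Scheme.IsRegular (affineBlowup 𝔳)) :
    Scheme.IsRegular (affineBlowup (R := Localization.AtPrime 𝔫) (maximalIdeal (Localization.AtPrime 𝔫))) := by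
  haveI : IsNoetherianRing (Localization.AtPrime 𝔫) :=
    IsLocalization.isNoetherianRing 𝔫.primeCompl (Localization.AtPrime 𝔫) inferInstance
  obtain ⟨h0, hadd, hm, hg⟩ := chartData_atPrime 𝔫 P χ hχ0 hχadd hχm hgen
  exact isRegular_affineBlowup_maximalIdeal_of_chartData_model
    ((algebraMap C (Localization.AtPrime 𝔫)).comp i) P hPfg _ h0 hadd hm hg hdim T 𝔳 hres χ₀ hχ₀0
    hχ₀add hχ₀m hgen₀ hdim₀ hreg

/-- ★★★ **`Bl_𝔫(Spec C_𝔫)` IS REGULAR from chart data at `𝔫` and the monomial model's vertex certificate.** As above with the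
model `κ(𝔫)[χᵈ : d ∈ G]` (`G` finite, `0 ∉ G`, `⟨G⟩ = P`) at its vertex: if `Bl_𝔳 Spec κ(𝔫)[χᵈ : d ∈ G]` is regular then so
is `Bl_𝔫(Spec C_𝔫)`. [cite: Kato1994, Thm. (3.2)] [cite: Matsumura1987, Thm. 8.11; Thm. 8.14; §32 p. 256] -/
theorem isRegular_affineBlowup_atPrime_of_chartData [IsNoetherianRing C] {K : Type} [Field K] (i : K →+* C)
    (G : Set (Fin n →₀ ℕ)) (hGfin : G.Finite) (hG0 : (0 : Fin n →₀ ℕ) ∉ G)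
    (P : AddSubmonoid (Fin n →₀ ℕ)) (hGP : AddSubmonoid.closure G = P)
    (χ : (Fin n →₀ ℕ) → C) (hχ0 : χ 0 = 1) (hχadd : ∀ a ∈ P, ∀ b ∈ P, χ (a + b) = χ a * χ b)
    (hχm : ∀ p ∈ P, p ≠ 0 → χ p ∈ 𝔫) (hgen : 𝔫 ≤ Ideal.span (χ '' {p | p ∈ P ∧ p ≠ 0}))
    (hdim : ringKrullDim (Localization.AtPrime 𝔫) = rank P)
    (hreg : Scheme.IsRegular (affineBlowup (Ideal.span {v : ↥(Algebra.adjoin (ResidueField (Localization.AtPrime 𝔫))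
        ((fun d : Fin n →₀ ℕ => MvPolynomial.monomial d (1 : ResidueField (Localization.AtPrime 𝔫))) '' G)) |
        ∃ d ∈ G, (v : MvPolynomial (Fin n) (ResidueField (Localization.AtPrime 𝔫))) = MvPolynomial.monomial d 1}))) :
    Scheme.IsRegular (affineBlowup (R := Localization.AtPrime 𝔫) (maximalIdeal (Localization.AtPrime 𝔫))) := by
  haveI : IsNoetherianRing (Localization.AtPrime 𝔫) :=
    IsLocalization.isNoetherianRing 𝔫.primeCompl (Localization.AtPrime 𝔫) inferInstance
  obtain ⟨h0, hadd, hm, hg⟩ := chartData_atPrime 𝔫 P χ hχ0 hχadd hχm hgen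
  exact isRegular_affineBlowup_maximalIdeal_of_chartData
    ((algebraMap C (Localization.AtPrime 𝔫)).comp i) G hGfin hG0 P hGP _ h0 hadd hm hg hdim hreg

/-- ★★★ **`Bl_𝔫(Spec C_𝔫)` IS REGULAR at a prime charted by the Veronese monoid `{m : r ∣ |m|}` (`r ≥ 1`, `dim C_𝔫 = n`)** — no
certificate (type `1/r(1,…,1)`). [cite: Kato1994, Thm. (3.2)] [cite: Kollar2007, §2.2] [cite: Matsumura1987, Thm. 8.11; §32 p. 256] -/
theorem isRegular_affineBlowup_atPrime_of_veroneseChart [IsNoetherianRing C] {K : Type} [Field K] (i : K →+* C)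
    (r : ℕ) (hr : 1 ≤ r)
    (χ : (Fin n →₀ ℕ) → C) (hχ0 : χ 0 = 1)
    (hχadd : ∀ a b : Fin n →₀ ℕ, r ∣ Finsupp.degree a → r ∣ Finsupp.degree b → χ (a + b) = χ a * χ b)
    (hχm : ∀ p : Fin n →₀ ℕ, r ∣ Finsupp.degree p → p ≠ 0 → χ p ∈ 𝔫)
    (hgen : 𝔫 ≤ Ideal.span (χ '' {p | r ∣ Finsupp.degree p ∧ p ≠ 0}))
    (hdim : ringKrullDim (Localization.AtPrime 𝔫) = n) :
    Scheme.IsRegular (affineBlowup (R := Localization.AtPrime 𝔫) (maximalIdeal (Localization.AtPrime 𝔫))) := by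
  haveI : IsNoetherianRing (Localization.AtPrime 𝔫) :=
    IsLocalization.isNoetherianRing 𝔫.primeCompl (Localization.AtPrime 𝔫) inferInstance
  refine isRegular_affineBlowup_maximalIdeal_of_veroneseChart
    ((algebraMap C (Localization.AtPrime 𝔫)).comp i) r hr (fun p => algebraMap C _ (χ p))
    (by simp only [hχ0, map_one]) (fun a b ha hb => by simp only [hχadd a b ha hb, map_mul]) (fun p hp hp0 => ?_) ?_ hdim
  · rw [← Localization.AtPrime.map_eq_maximalIdeal]
    exact Ideal.mem_map_of_mem _ (hχm p hp hp0)
  · rw [← Localization.AtPrime.map_eq_maximalIdeal]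
    refine (Ideal.map_mono hgen).trans ?_
    rw [Ideal.map_span, ← Set.image_comp]
    rfl

end Summit.ResolutionOfSingularities.ResolutionOfSingularities.Theorems.FRationalResolution.LocalToricModelBlowup

end
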